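import Summits.Ventures.CertifiedArithmetic.LowPrec.PatternBands

/-!
# The low range (subnormal results): grid and value-level error formulas of the four roundings

Venture: CertifiedArithmetic (T1-LOWPREC-ENVELOPES). HONEST FRAMING: certified error envelopes and
provably optimal rounding/accumulation schemes for low-precision formats under stated cost models;
every table by two implementations; no hardware or vendor claims.

`SignificandError.lean` / `SignificandErrorValue.lean` give the error of the four roundings of a
value `|x| = n · 2^s / 2^k · quantum` placed in a NORMAL binade (`2^(m+k) ≤ n < 2^(m+k+1)`). This
file is the companion for the LOW RANGE `|x| < 2^(m+1) · quantum` — the subnormal range of the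
destination together with its first normal binade, where the grid of the format is the uniform grid
`quantum · ℕ`: for `|x| = n / 2^k · quantum` with `n < 2^(m+1) · 2^k` (and `|x| ≤ maxRat`) the
spacing exponent is `0` (`Format.shift_floor_low`), so that

* `|x − RNE x| = min(rem, 2^k − rem) / 2^k · quantum` (`MiniFloat.abs_sub_roundNE_low`),
* `|x − RZ x| = rem / 2^k · quantum` (`abs_sub_roundTowardZero_low`),
* `x − RD x = rem / 2^k · quantum` for `x ≥ 0` and `(2^k − rem) / 2^k · quantum` (`0` if `rem = 0`)
  for `x < 0` (`sub_roundDown_low`, `sub_roundDown_low_neg`), and the mirror images for `RU`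
  (`roundUp_sub_low`, `roundUp_sub_low_neg`),

`rem = n mod 2^k` — the error in units of the quantum (= the ulp of the whole low range) is a
function of `(n, k)`: `lowErrNE`, `lowErrTZ`, `lowErrAW`, `lowErrDir`. These are the bridges of
the subnormal bands of THEOREMS-R1-BANDS (Remark E5′; `PatternSubnormalBands.lean`), whose
kernel-reducible band test `Format.lowBandB γ N E` (low band `γ`: `2^m ≤ N · 2^E · 2^(γ+1) <
2^(m+1)`, in range) and low pattern `(lowN, lowK)` of a magnitude `N · 2^E` (`N · 2^E = lowN /
2^lowK`) close the file.
-/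

namespace Literature.ComputerArithmetic.FloatingPoint

namespace Format

variable {φ : Format}

/-- LOW-RANGE ERROR NUMERATORS over `2^k`, nearest: `min(rem, 2^k - rem) / 2^k`. [folklore] -/
def lowErrNE (n k : ℕ) : ℚ := ((min (n % 2 ^ k) (2 ^ k - n % 2 ^ k) : ℕ) : ℚ) / 2 ^ k

/-- Low range, toward zero: `rem / 2^k`. [folklore] -/
def lowErrTZ (n k : ℕ) : ℚ := ((n % 2 ^ k : ℕ) : ℚ) / 2 ^ k

/-- Low range, away from zero: `(2^k - rem) / 2^k`, `0` if `rem = 0`. [folklore] -/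
def lowErrAW (n k : ℕ) : ℚ := ((if n % 2 ^ k = 0 then 0 else 2 ^ k - n % 2 ^ k : ℕ) : ℚ) / 2 ^ k

/-- Low range, round down / round up over both signs: `max(TZ, AW)`. [folklore] -/
def lowErrDir (n k : ℕ) : ℚ := max (lowErrTZ n k) (lowErrAW n k)

/-- `lowErrNE ≥ 0`. [folklore] -/
theorem lowErrNE_nonneg (n k : ℕ) : 0 ≤ lowErrNE n k := by unfold lowErrNE; positivity

/-- `lowErrTZ ≥ 0`. [folklore] -/
theorem lowErrTZ_nonneg (n k : ℕ) : 0 ≤ lowErrTZ n k := by unfold lowErrTZ; positivity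

/-- `lowErrAW ≥ 0`. [folklore] -/
theorem lowErrAW_nonneg (n k : ℕ) : 0 ≤ lowErrAW n k := by unfold lowErrAW; positivity

/-- `lowErrDir ≥ 0`. [folklore] -/
theorem lowErrDir_nonneg (n k : ℕ) : 0 ≤ lowErrDir n k :=
  le_trans (lowErrTZ_nonneg n k) (le_max_left _ _)

/-- LOW RANGE HAS SPACING EXPONENT `0`: `⌊n / 2^k⌋ < 2^(m+1)`. [folklore] -/
theorem shift_floor_low {n k : ℕ} (hlow : n < 2 ^ (φ.manBits + 1) * 2 ^ k) :
    φ.shift ⌊(n : ℚ) / 2 ^ k⌋.toNat = 0 := by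
  rw [floor_natCast_div_two_pow, Int.toNat_natCast]
  exact shift_eq_zero_of_lt ((Nat.div_lt_iff_lt_mul (Nat.two_pow_pos k)).mpr hlow)

/-- RNE on the low grid is rounding to the nearest integer number of quanta. [folklore] -/
theorem rneGrid_low {n k : ℕ} (hlow : n < 2 ^ (φ.manBits + 1) * 2 ^ k)
    (hle : (n : ℚ) / 2 ^ k ≤ φ.maxScaled) :
    (φ.rneGrid ((n : ℚ) / 2 ^ k) : ℚ) = (rneInt ((n : ℚ) / 2 ^ k) : ℚ) := by
  have hr : (0 : ℚ) ≤ (n : ℚ) / 2 ^ k := by positivity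
  rw [rneGrid_eq_min, min_eq_left (rneMult_le_maxScaled_of_le hr hle), rneMult_cast hr,
    shift_floor_low hlow, pow_zero, div_one, mul_one]

/-- NEAREST, LOW GRID: `|r - rneGrid r| = min(rem, 2^k - rem) / 2^k`. [folklore] -/
theorem abs_sub_rneGrid_low {n k : ℕ} (hlow : n < 2 ^ (φ.manBits + 1) * 2 ^ k)
    (hle : (n : ℚ) / 2 ^ k ≤ φ.maxScaled) :
    |(n : ℚ) / 2 ^ k - (φ.rneGrid ((n : ℚ) / 2 ^ k) : ℚ)| = lowErrNE n k := by
  rw [rneGrid_low hlow hle, abs_sub_rneInt_natCast_div_two_pow, lowErrNE]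

/-- ROUND DOWN on the low grid is the integer quotient. [folklore] -/
theorem rdGrid_low {n k : ℕ} (hlow : n < 2 ^ (φ.manBits + 1) * 2 ^ k)
    (hle : (n : ℚ) / 2 ^ k ≤ φ.maxScaled) : φ.rdGrid ((n : ℚ) / 2 ^ k) = n / 2 ^ k := by
  have hr : (0 : ℚ) ≤ (n : ℚ) / 2 ^ k := by positivity
  rw [rdGrid_eq_floor_mul hr hle, shift_floor_low hlow, pow_zero, pow_zero, div_one, mul_one,
    floor_natCast_div_two_pow, Int.toNat_natCast]

/-- TOWARD ZERO, LOW GRID: `r - rdGrid r = rem / 2^k`. [folklore] -/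
theorem sub_rdGrid_low {n k : ℕ} (hlow : n < 2 ^ (φ.manBits + 1) * 2 ^ k)
    (hle : (n : ℚ) / 2 ^ k ≤ φ.maxScaled) :
    (n : ℚ) / 2 ^ k - (φ.rdGrid ((n : ℚ) / 2 ^ k) : ℚ) = lowErrTZ n k := by
  rw [rdGrid_low hlow hle, lowErrTZ, natCast_div_two_pow n k]
  ring

/-- ROUND UP on the low grid is the integer ceiling. [folklore] -/
theorem ruGrid_low {n k : ℕ} (hlow : n < 2 ^ (φ.manBits + 1) * 2 ^ k)
    (hle : (n : ℚ) / 2 ^ k ≤ φ.maxScaled) :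
    φ.ruGrid ((n : ℚ) / 2 ^ k) = n / 2 ^ k + if n % 2 ^ k = 0 then 0 else 1 := by
  unfold ruGrid
  rw [if_pos hle, shift_floor_low hlow, pow_zero, pow_zero, div_one, mul_one,
    ceil_natCast_div_two_pow]
  split_ifs
  · rw [add_zero, add_zero, Int.toNat_natCast]
  · rw [← Nat.cast_succ, Int.toNat_natCast]

/-- AWAY, LOW GRID: `ruGrid r - r = (2^k - rem) / 2^k`, `0` if `rem = 0`. [folklore] -/
theorem ruGrid_sub_low {n k : ℕ} (hlow : n < 2 ^ (φ.manBits + 1) * 2 ^ k)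
    (hle : (n : ℚ) / 2 ^ k ≤ φ.maxScaled) :
    (φ.ruGrid ((n : ℚ) / 2 ^ k) : ℚ) - (n : ℚ) / 2 ^ k = lowErrAW n k := by
  have hρ : n % 2 ^ k < 2 ^ k := Nat.mod_lt n (Nat.two_pow_pos k)
  have hdec := natCast_div_two_pow n k
  rw [ruGrid_low hlow hle, lowErrAW]
  split_ifs with h0
  · push_cast
    rw [hdec, h0]
    simp
  · push_cast [Nat.cast_sub hρ.le]
    rw [hdec]
    field_simp
    ring

/-! ### The low bands and the low pattern of a magnitude `N · 2^E` -/

/-- CORE LOW-BAND TEST on `E' = E + γ + 1`: `2^m ≤ N · 2^E' < 2^(m+1)` in natural-number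
arithmetic on both signs of `E'`. [folklore] -/
def lowCoreB (m N : ℕ) : ℤ → Bool
  | Int.ofNat d => decide (2 ^ m ≤ N * 2 ^ d ∧ N * 2 ^ d < 2 ^ (m + 1))
  | Int.negSucc d => decide (2 ^ m * 2 ^ (d + 1) ≤ N ∧ N < 2 ^ (m + 1) * 2 ^ (d + 1))

/-- IN-RANGE TEST `N · 2^E ≤ maxScaled` in natural-number arithmetic. [folklore] -/
def inRangeB (R : Format) (N : ℕ) : ℤ → Bool
  | Int.ofNat e => decide (N * 2 ^ e ≤ R.maxScaled)
  | Int.negSucc e => decide (N ≤ R.maxScaled * 2 ^ (e + 1))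

/-- LOW-BAND TEST: the magnitude `N · 2^E` quanta of `R` lies in low band `γ`,
`2^m ≤ N · 2^E · 2^(γ+1) < 2^(m+1)`, and is in range. [folklore] -/
def lowBandB (R : Format) (γ N : ℕ) (E : ℤ) : Bool :=
  lowCoreB R.manBits N (E + ((γ + 1 : ℕ) : ℤ)) && R.inRangeB N E

/-- `lowCoreB` over the rationals. [folklore] -/
theorem lowCoreB_eq_true_iff {m N : ℕ} {E' : ℤ} : lowCoreB m N E' = true ↔
    (2 : ℚ) ^ m ≤ (N : ℚ) * 2 ^ E' ∧ (N : ℚ) * 2 ^ E' < 2 ^ (m + 1) := by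
  cases E' with
  | ofNat d =>
    rw [lowCoreB, decide_eq_true_iff, Int.ofNat_eq_natCast, zpow_natCast]
    constructor
    · rintro ⟨h1, h2⟩; exact ⟨by exact_mod_cast h1, by exact_mod_cast h2⟩
    · rintro ⟨h1, h2⟩; exact ⟨by exact_mod_cast h1, by exact_mod_cast h2⟩
  | negSucc d =>
    have hp : (0 : ℚ) < 2 ^ (d + 1) := by positivity
    rw [lowCoreB, decide_eq_true_iff, zpow_negSucc, ← div_eq_mul_inv, le_div_iff₀ hp,
      div_lt_iff₀ hp]
    constructor
    · rintro ⟨h1, h2⟩; exact ⟨by exact_mod_cast h1, by exact_mod_cast h2⟩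
    · rintro ⟨h1, h2⟩; exact ⟨by exact_mod_cast h1, by exact_mod_cast h2⟩

/-- `inRangeB` over the rationals. [folklore] -/
theorem inRangeB_eq_true_iff {R : Format} {N : ℕ} {E : ℤ} : R.inRangeB N E = true ↔
    (N : ℚ) * 2 ^ E ≤ (R.maxScaled : ℚ) := by
  cases E with
  | ofNat e =>
    rw [inRangeB, decide_eq_true_iff, Int.ofNat_eq_natCast, zpow_natCast]
    constructor
    · intro h; exact_mod_cast h
    · intro h; exact_mod_cast h
  | negSucc e =>
    have hp : (0 : ℚ) < 2 ^ (e + 1) := by positivity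
    rw [inRangeB, decide_eq_true_iff, zpow_negSucc, ← div_eq_mul_inv, div_le_iff₀ hp]
    constructor
    · intro h; exact_mod_cast h
    · intro h; exact_mod_cast h

/-- `lowBandB` over the rationals. [folklore] -/
theorem lowBandB_eq_true_iff {R : Format} {γ N : ℕ} {E : ℤ} : R.lowBandB γ N E = true ↔
    (2 : ℚ) ^ R.manBits ≤ (N : ℚ) * 2 ^ E * 2 ^ (γ + 1) ∧
      (N : ℚ) * 2 ^ E * 2 ^ (γ + 1) < 2 ^ (R.manBits + 1) ∧ (N : ℚ) * 2 ^ E ≤ (R.maxScaled : ℚ) := by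
  have e : (N : ℚ) * 2 ^ E * 2 ^ (γ + 1) = (N : ℚ) * 2 ^ (E + ((γ + 1 : ℕ) : ℤ)) := by
    rw [zpow_add₀ (by norm_num : (2 : ℚ) ≠ 0), zpow_natCast, mul_assoc]
  rw [lowBandB, Bool.and_eq_true, lowCoreB_eq_true_iff, inRangeB_eq_true_iff, e]
  exact and_assoc

/-- `lowBandB γ N E` says that a value of magnitude `N · 2^E · quantum_R` lies in low band `γ`:
`2^m · quantum ≤ |t| · 2^(γ+1) < 2^(m+1) · quantum`, and `|t| ≤ maxRat`. [folklore] -/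
theorem lowBandB_iff_of_eq {R : Format} {t : ℚ} {γ N : ℕ} {E : ℤ}
    (ht : |t| = (N : ℚ) * 2 ^ E * R.quantum) :
    R.lowBandB γ N E = true ↔ 2 ^ R.manBits * R.quantum ≤ |t| * 2 ^ (γ + 1) ∧
      |t| * 2 ^ (γ + 1) < 2 ^ (R.manBits + 1) * R.quantum ∧ |t| ≤ R.maxRat := by
  have hq := R.quantum_pos
  have e : (N : ℚ) * 2 ^ E * R.quantum * 2 ^ (γ + 1) = (N : ℚ) * 2 ^ E * 2 ^ (γ + 1) * R.quantum := by
    ring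
  rw [lowBandB_eq_true_iff, ht, Format.maxRat, e]
  constructor
  · rintro ⟨h1, h2, h3⟩
    exact ⟨mul_le_mul_of_nonneg_right h1 hq.le, mul_lt_mul_of_pos_right h2 hq,
      mul_le_mul_of_nonneg_right h3 hq.le⟩
  · rintro ⟨h1, h2, h3⟩
    exact ⟨le_of_mul_le_mul_right h1 hq, lt_of_mul_lt_mul_right h2 hq.le,
      le_of_mul_le_mul_right h3 hq⟩

/-- LOW PATTERN NUMERATOR of `N · 2^E = n / 2^k`: `n = N · 2^E` (`E ≥ 0`) or `N`. [folklore] -/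
def lowN (N : ℕ) : ℤ → ℕ
  | Int.ofNat d => N * 2 ^ d
  | Int.negSucc _ => N

/-- LOW PATTERN DENOMINATOR EXPONENT: `k = 0` (`E ≥ 0`) or `-E`. [folklore] -/
def lowK : ℤ → ℕ
  | Int.ofNat _ => 0
  | Int.negSucc d => d + 1

/-- `N · 2^E = lowN / 2^lowK`. [folklore] -/
theorem lowNK_spec (N : ℕ) (E : ℤ) : (N : ℚ) * 2 ^ E = ((lowN N E : ℕ) : ℚ) / 2 ^ lowK E := by
  cases E with
  | ofNat d =>
    show (N : ℚ) * 2 ^ ((d : ℕ) : ℤ) = ((N * 2 ^ d : ℕ) : ℚ) / 2 ^ (0 : ℕ)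
    rw [zpow_natCast, pow_zero, div_one]
    push_cast
    ring
  | negSucc d =>
    show (N : ℚ) * 2 ^ (Int.negSucc d) = (N : ℚ) / 2 ^ (d + 1)
    rw [zpow_negSucc, div_eq_mul_inv]

/-- A magnitude in a low band is a low pattern: `lowN < 2^(m+1) · 2^lowK`. [folklore] -/
theorem lowN_lt_of_lowBandB {R : Format} {γ N : ℕ} {E : ℤ} (h : R.lowBandB γ N E = true) :
    lowN N E < 2 ^ (R.manBits + 1) * 2 ^ lowK E := by
  obtain ⟨-, h2, -⟩ := lowBandB_eq_true_iff.mp h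
  have hD : (0 : ℚ) < 2 ^ lowK E := by positivity
  have h0 : (0 : ℚ) ≤ (N : ℚ) * 2 ^ E := mul_nonneg (Nat.cast_nonneg _) (zpow_nonneg (by norm_num) _)
  have h1 : (N : ℚ) * 2 ^ E ≤ (N : ℚ) * 2 ^ E * 2 ^ (γ + 1) :=
    le_mul_of_one_le_right h0 (one_le_pow₀ (by norm_num))
  have h3 : ((lowN N E : ℕ) : ℚ) / 2 ^ lowK E < 2 ^ (R.manBits + 1) := by
    rw [← lowNK_spec]; linarith
  rw [div_lt_iff₀ hD] at h3
  exact_mod_cast h3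

/-- The low-pattern form of a magnitude `N · 2^E · quantum`. [folklore] -/
theorem abs_low_of_eq {R : Format} {t : ℚ} {N : ℕ} {E : ℤ}
    (ht : |t| = (N : ℚ) * 2 ^ E * R.quantum) :
    |t| = ((lowN N E : ℕ) : ℚ) / 2 ^ lowK E * R.quantum := by
  rw [ht, lowNK_spec]

/-- The entry of one placed pattern (empty if not placed in low band `γ`). [folklore] -/
def lowEntry (errL : ℕ → ℕ → ℚ) (R : Format) (γ N : ℕ) (E : ℤ) : List ℚ :=
  if R.lowBandB γ N E then [errL (lowN N E) (lowK E)] else []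

/-- Membership in `lowEntry`. [folklore] -/
theorem mem_lowEntry {errL : ℕ → ℕ → ℚ} {R : Format} {γ N : ℕ} {E : ℤ} {c : ℚ} :
    c ∈ lowEntry errL R γ N E ↔ R.lowBandB γ N E = true ∧ c = errL (lowN N E) (lowK E) := by
  unfold lowEntry
  split_ifs with h <;> simp [h]

end Format

namespace MiniFloat

open Format

variable {φ : Format}

/-- The scaled magnitude of a low value. [folklore] -/
theorem scaledInput_low {x : ℚ} {n k : ℕ} (hx : |x| = (n : ℚ) / 2 ^ k * φ.quantum) :
    |x| / φ.quantum = (n : ℚ) / 2 ^ k := by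
  rw [hx, mul_div_cancel_right₀ _ (ne_of_gt φ.quantum_pos)]

/-- In range in quanta. [folklore] -/
theorem low_le_maxScaled {x : ℚ} {n k : ℕ} (hx : |x| = (n : ℚ) / 2 ^ k * φ.quantum)
    (hmax : |x| ≤ φ.maxRat) : (n : ℚ) / 2 ^ k ≤ φ.maxScaled := by
  rw [hx] at hmax
  unfold Format.maxRat at hmax
  exact le_of_mul_le_mul_right hmax φ.quantum_pos

/-- NEAREST, LOW RANGE: `|x - RNE x| = min(rem, 2^k - rem) / 2^k · quantum` for
`|x| = n / 2^k · quantum ≤ maxRat`, `n < 2^(m+1) · 2^k`. [folklore] -/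
theorem abs_sub_roundNE_low {x : ℚ} {n k : ℕ} (hlow : n < 2 ^ (φ.manBits + 1) * 2 ^ k)
    (hx : |x| = (n : ℚ) / 2 ^ k * φ.quantum) (hmax : |x| ≤ φ.maxRat) :
    |x - (roundNE φ x).toRat| = lowErrNE n k * φ.quantum := by
  rw [abs_sub_roundNE, scaledInput_low hx, abs_sub_rneGrid_low hlow (low_le_maxScaled hx hmax)]

/-- TOWARD ZERO, LOW RANGE: `|x - RZ x| = rem / 2^k · quantum`. [folklore] -/
theorem abs_sub_roundTowardZero_low {x : ℚ} {n k : ℕ} (hlow : n < 2 ^ (φ.manBits + 1) * 2 ^ k)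
    (hx : |x| = (n : ℚ) / 2 ^ k * φ.quantum) (hmax : |x| ≤ φ.maxRat) :
    |x - (roundTowardZero φ x).toRat| = lowErrTZ n k * φ.quantum := by
  rw [abs_sub_roundTowardZero, scaledInput_low hx,
    sub_rdGrid_low hlow (low_le_maxScaled hx hmax)]

/-- ROUND DOWN, LOW RANGE, `x ≥ 0`: `x - RD x = rem / 2^k · quantum`. [folklore] -/
theorem sub_roundDown_low {x : ℚ} {n k : ℕ} (hx0 : 0 ≤ x)
    (hlow : n < 2 ^ (φ.manBits + 1) * 2 ^ k) (hx : |x| = (n : ℚ) / 2 ^ k * φ.quantum)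
    (hmax : |x| ≤ φ.maxRat) : x - (roundDown φ x).toRat = lowErrTZ n k * φ.quantum := by
  rw [sub_roundDown_eq, if_neg (not_lt.mpr hx0), scaledInput_low hx,
    sub_rdGrid_low hlow (low_le_maxScaled hx hmax)]

/-- ROUND DOWN, LOW RANGE, `x < 0`: `x - RD x = (2^k - rem) / 2^k · quantum` (`0` if `rem = 0`).
[folklore] -/
theorem sub_roundDown_low_neg {x : ℚ} {n k : ℕ} (hx0 : x < 0)
    (hlow : n < 2 ^ (φ.manBits + 1) * 2 ^ k) (hx : |x| = (n : ℚ) / 2 ^ k * φ.quantum)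
    (hmax : |x| ≤ φ.maxRat) : x - (roundDown φ x).toRat = lowErrAW n k * φ.quantum := by
  rw [sub_roundDown_eq, if_pos hx0, scaledInput_low hx,
    ruGrid_sub_low hlow (low_le_maxScaled hx hmax)]

/-- ROUND UP, LOW RANGE, `x > 0`: `RU x - x = (2^k - rem) / 2^k · quantum` (`0` if `rem = 0`).
[folklore] -/
theorem roundUp_sub_low {x : ℚ} {n k : ℕ} (hx0 : 0 < x)
    (hlow : n < 2 ^ (φ.manBits + 1) * 2 ^ k) (hx : |x| = (n : ℚ) / 2 ^ k * φ.quantum)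
    (hmax : |x| ≤ φ.maxRat) : (roundUp φ x).toRat - x = lowErrAW n k * φ.quantum := by
  have h := sub_roundDown_low_neg (φ := φ) (x := -x) (neg_lt_zero.mpr hx0) hlow
    (by rwa [abs_neg]) (by rwa [abs_neg])
  rw [toRat_roundDown_neg] at h
  linarith

/-- ROUND UP, LOW RANGE, `x ≤ 0`: `RU x - x = rem / 2^k · quantum`. [folklore] -/
theorem roundUp_sub_low_neg {x : ℚ} {n k : ℕ} (hx0 : x ≤ 0)
    (hlow : n < 2 ^ (φ.manBits + 1) * 2 ^ k) (hx : |x| = (n : ℚ) / 2 ^ k * φ.quantum)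
    (hmax : |x| ≤ φ.maxRat) : (roundUp φ x).toRat - x = lowErrTZ n k * φ.quantum := by
  have h := sub_roundDown_low (φ := φ) (x := -x) (by linarith) hlow
    (by rwa [abs_neg]) (by rwa [abs_neg])
  rw [toRat_roundDown_neg] at h
  linarith

/-- ROUND DOWN, LOW RANGE, both signs: `|x - RD x| ≤ lowErrDir n k · quantum`. [folklore] -/
theorem abs_sub_roundDown_low_le {x : ℚ} {n k : ℕ} (hlow : n < 2 ^ (φ.manBits + 1) * 2 ^ k)
    (hx : |x| = (n : ℚ) / 2 ^ k * φ.quantum) (hmax : |x| ≤ φ.maxRat) :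
    |x - (roundDown φ x).toRat| ≤ lowErrDir n k * φ.quantum := by
  have hq := φ.quantum_pos
  rcases lt_or_ge x 0 with hneg | hpos
  · rw [sub_roundDown_low_neg hneg hlow hx hmax,
      abs_of_nonneg (mul_nonneg (lowErrAW_nonneg n k) hq.le)]
    exact mul_le_mul_of_nonneg_right (le_max_right _ _) hq.le
  · rw [sub_roundDown_low hpos hlow hx hmax,
      abs_of_nonneg (mul_nonneg (lowErrTZ_nonneg n k) hq.le)]
    exact mul_le_mul_of_nonneg_right (le_max_left _ _) hq.le

/-- ROUND UP, LOW RANGE, both signs: `|x - RU x| ≤ lowErrDir n k · quantum`. [folklore] -/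
theorem abs_sub_roundUp_low_le {x : ℚ} {n k : ℕ} (hlow : n < 2 ^ (φ.manBits + 1) * 2 ^ k)
    (hx : |x| = (n : ℚ) / 2 ^ k * φ.quantum) (hmax : |x| ≤ φ.maxRat) :
    |x - (roundUp φ x).toRat| ≤ lowErrDir n k * φ.quantum := by
  have hq := φ.quantum_pos
  rcases le_or_gt x 0 with hneg | hpos
  · rw [abs_sub_comm, roundUp_sub_low_neg hneg hlow hx hmax,
      abs_of_nonneg (mul_nonneg (lowErrTZ_nonneg n k) hq.le)]
    exact mul_le_mul_of_nonneg_right (le_max_left _ _) hq.le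
  · rw [abs_sub_comm, roundUp_sub_low hpos hlow hx hmax,
      abs_of_nonneg (mul_nonneg (lowErrAW_nonneg n k) hq.le)]
    exact mul_le_mul_of_nonneg_right (le_max_right _ _) hq.le

end MiniFloat

end Literature.ComputerArithmetic.FloatingPoint
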